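import Literature.AnabelianGeometry.EtaleTheta.TemperedFrobenioidToyShearData
import Literature.AnabelianGeometry.EtaleTheta.FrdIVocabulary
import Literature.AlgebraicGeometry.Frobenioids.MonoidTransport
import Literature.AlgebraicGeometry.Frobenioids.PerfectionPreFrobenioid
import HarnessLib

/-!
# [EtTh] Def. 3.6 (ii) / [FrdI] Prop. 4.1 (iii): the «coprimality-pull-back law» `hDSpull` is NOT a consequence of
# the typed tempered-Frobenioid structure — a Galois double cover with a SHEAR pull-back (kernel certificate)

S. Mochizuki, *The étale theta function …*, Publ. RIMS **45** (2009) [MochizukiEtTh2009], §3 Def. 3.3 (iii) (PDF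
p.73), Def. 3.6 (i)(ii) pp.76–77, §4 Def. 4.1 (i) p.86 («`Div(s′)`, `Div(s″)` have disjoint supports [cf. [FrdI],
Proposition 4.1, (iii)]»), proof of Prop. 4.2 (iii) pp.89–90 [cite: MochizukiEtTh2009, Def 3.6 p.77]; S. Mochizuki,
*The geometry of Frobenioids I* (2008) [MochizukiFrdI2008], Def. 1.1 (ii) p.19 (monoids on a category).

abc-iut cell, layer L2; seat abc-iut-L2-t3 (gen 6), OWNER lineage of the Def. 3.6 (ii) structure `TemperedFrobenioid`.
GAP-LEDGER row **G-w5d063-1** (abc-iut-w5-d063): every law-level closer of [EtTh] Prop. 4.2 (iii) at the canonical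
§4 model / genuine connected base (`Prop42Sub.prop42_iii_iv_mkOfModelCanonical_of_laws` p428253, …) carries BY NAME
`hDSpull : ∀ {A A′} (e : A′ ⟶ A) {a b : Φ(A)}, (a, b coprime in Φ(A)) → (pull e a, pull e b coprime in Φ(A′))`, and the
row asserts — informally; positive toys only (`ToyCov/ToyCovZ/ToyTower.coprime_pull`) — that this law «is not
implied by the [FrdI] Def 1.1 / Def 2.4 monoid axioms the structure records».  THIS FILE (part 2; the Def. 3.3
(iii) / 3.6 (i) data are part 1, `TemperedFrobenioidToyShearData.lean`) MAKES THAT A KERNEL CERTIFICATE (pattern of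
abc-iut-f-015's `TemperedFrobenioidToyTwoPrimes.lean`):
* base `D = D₀ := WithTerminal (SingleObj (ℤ/2))`: a Galois double cover `Y′ → Y` (`Aut(Y′/Y) = ℤ/2`, `Y` terminal);
  `σ ≫ cov = cov` for the deck transformation `σ ≠ 1`, so the cover `cov` is NOT a monomorphism, hence NOT an
  FSM-morphism (`not_isFSM_cov`) — clause (b) of [FrdI] Def. 1.1 (ii) says nothing about its pull-back, exactly as
  for a genuine covering in `B^temp(Π)⁰` (monomorphisms of connected objects are isomorphisms);
* `Φ₀(Y) = Φ₀(Y′) = ℤ²_{≥0} = ⟨e₀, e₁⟩` (abc-iut-L1's `PiNat`); deck transformations pull back by the identity, the cover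
  by the **SHEAR** `e₀ ↦ e₀ + e₁`, `e₁ ↦ e₁` (injective, characteristically injective); `B₀ = B₀^Λ = Φ₀^gp`, `Div = id`,
  `F₀ = 1`, `F₀^Λ = ℝ·Φ₀^cnst = {g | g₀ = 0}` (shear-stable, root-closed), `Λ = ℤ`, `Φ₀^ℝ := Φ₀` over the trivial
  MONOID vocabulary `Toy.monoidVocab` (as every §3/§4 toy of the cell);
* `ShearToy.temperedFrobenioid`: EVERY field of `TemperedFrobenioid` holds, base functor the IDENTITY (full, essentially
  surjective), `Φ = Φ^{ℝ-log}`, `Φ^{bs-fld} = ℤ_{≥0}·e₁` monoprime (REAL), Def. 3.6 (ii)(b) via the constant `e₁`; the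
  CATEGORY vocabulary is the tree's `treeCatVocab`: [FrdI] Def. 1.1 (ii) «`Φ` is a monoid on `D`» (pull-backs
  characteristically injective, FSM-morphisms pull back bijectively) and «`Φ` divisorial» are PROVED (`isMonoidOn_Φ`,
  `isDivisorial_Φ`), not stubbed;
* **`ShearToy.not_coprimePull`**: `e₀`, `e₁` are coprime over `Y`, their pull-backs `e₀ + e₁`, `e₁` over `Y′` share the
  divisor `e₁ ≠ 0` — `hDSpull`, VERBATIM as the consumers carry it, is FALSE here; `not_forall_coprimePull`.
READING: `hDSpull` is a GENUINE law of the Def. 3.3 (iii) / 3.6 (ii) data (pull-back of divisors ARISING FROM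
GEOMETRY: fibres over distinct primes are disjoint; print has it from the curve, cf. [FrdI] Prop. 4.1 (iii)),
independent of what the typed structure records — G-w5d063-1's disposition «carry BY NAME / v-next FIELD» is
kernel-justified.  A SCHEMA certificate about OUR typed interface; it refutes nothing in [EtTh]/[FrdI] and says nothing
about tempered Frobenioids of curves.  HONEST LIMITS: trivial monoid vocabulary (`ℤ²_{≥0}` is in fact perf-factorial and
the shear extends to its realification `ℝ²_{≥0}`, where the same two elements refute the law — not formalised); one
non-trivial covering; not a curve.  Nothing here bears on the disputed [IUTchIII] Cor. 3.12; no side taken.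
-/

noncomputable section

namespace Literature.AnabelianGeometry.EtaleTheta

open CategoryTheory Opposite Function Literature.AlgebraicGeometry.Frobenioids

namespace ShearToy

/-! ### §4 The tempered Frobenioid: Def. 3.6 (ii) with the tree's [FrdI] Def. 1.1 (ii) category vocabulary -/

/-- The tree's [FrdI] category vocabulary on the base (`IsDivisorialOn Φ := IsMonoidOn Φ ∧ objectwise divisorial`),
with the [FrdI] Def. 4.5 rationality slots trivial. [cite: MochizukiEtTh2009, Def 3.6 p.77] -/
def catVocab : FrdICatStub.{0, 0, 0} Base := treeCatVocab Base (fun _ => True) (fun _ => True)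

/-- `Φ := Φ^{ℝ-log}` (everything), as a subfunctor in monoids. [cite: MochizukiEtTh2009, Def 3.6 p.77] -/
def ΦSub : SubMonoidOn ((𝟭 Base).op ⋙ realified.ΦR) := ⟨fun _ => ⊤, fun _ _ _ => trivial⟩

/-- `Φ(A) = ⊤ ≅ ℤ²_{≥0}` is divisorial (abc-iut-L1's `PiNat.isDivisorial`, transported).
[cite: MochizukiFrdI2008, Def. 1.1(i) p.19] -/
theorem isDivisorial_Φ (A : Baseᵒᵖ) : IsDivisorial (ΦSub.carrier A) :=
  IsDivisorial.of_mulEquiv (Submonoid.topEquiv (M := M)).symm PiNat.isDivisorial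

/-- `Φ(A)` is sharp. [cite: MochizukiFrdI2008, §0 p.11] -/
theorem isSharp_Φ (A : Baseᵒᵖ) : IsSharp (ΦSub.carrier A) :=
  IsSharp.of_mulEquiv (Submonoid.topEquiv (M := M)).symm PiNat.isSharp

/-- Values of the pull-back of `Φ`. [cite: MochizukiEtTh2009, Def 3.6 p.76] -/
theorem coe_pull_ΦSub {P Q : Base} (a : P ⟶ Q) (x : ΦSub.carrier (op Q)) :
    ((pull ΦSub.toFunctor a x).1 : M) = pullHom a (x.1 : M) := rfl

/-- Every pull-back of `Φ` is injective. [cite: MochizukiFrdI2008, Def. 1.1(ii) p.19] -/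
theorem pull_Φ_injective {P Q : Base} (a : P ⟶ Q) : Injective (pull ΦSub.toFunctor a) := fun _ _ h =>
  Subtype.ext (pullHom_injective a (congrArg Subtype.val h))

/-- **[FrdI] Def. 1.1 (ii) HOLDS for `Φ`** (GENUINE, not a vocabulary stub): (a) every pull-back is characteristically
injective (injective into a sharp monoid); (b) FSM-morphisms pull back to bijections — the identity along `Y′ ⟶ Y′`
and `Y ⟶ Y`, while the cover `Y′ ⟶ Y` is not FSM. [cite: MochizukiFrdI2008, Def. 1.1(ii) p.19] -/
theorem isMonoidOn_Φ : IsMonoidOn ΦSub.toFunctor := by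
  refine ⟨fun {A B} α =>
      isCharInjective_of_injective_of_isSharp_target _ (pull_Φ_injective α) (isSharp_Φ (op B)),
    fun {A B} α hα => ?_⟩
  revert α hα
  match A, B with
  | .of _, .of _ => exact fun α _ => ⟨pull_Φ_injective α, fun y => ⟨y, rfl⟩⟩
  | .star, .star => exact fun α _ => ⟨pull_Φ_injective α, fun y => ⟨y, rfl⟩⟩
  | .star, .of _ => exact fun α hα => absurd hα (by rw [hom_Y'_Y_eq α]; exact not_isFSM_cov)
  | .of _, .star => exact fun α _ => (WithTerminal.false_of_from_star α).elim

/-- Every arrow of the base is an epimorphism (deck transformations are invertible; the maps to the terminal `Y` are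
unique). [cite: MochizukiFrdI2008, §0 p.13] -/
theorem epi_base : ∀ {P Q : Base} (f : P ⟶ Q), Epi f
  | .of _, .of _, f => ⟨fun {Z} g h w => by
      match Z, g, h, w with
      | .of _, g, h, w =>
        have w' : (show G from WithTerminal.down g) * (show G from WithTerminal.down f) =
            (show G from WithTerminal.down h) * (show G from WithTerminal.down f) := w
        exact (mul_right_cancel w' : (show G from WithTerminal.down g) = (show G from WithTerminal.down h))
      | .star, g, h, _ => rfl⟩
  | .of _, .star, _ => ⟨fun {Z} g h _ => by
      match Z, g, h with
      | .star, g, h => rfl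
      | .of _, g, _ => exact (WithTerminal.false_of_from_star g).elim⟩
  | .star, .star, _ => ⟨fun {Z} g h _ => by
      match Z, g, h with
      | .star, g, h => rfl
      | .of _, g, _ => exact (WithTerminal.false_of_from_star g).elim⟩
  | .star, .of _, f => (WithTerminal.false_of_from_star f).elim

/-- **The typed tempered-Frobenioid interface is satisfied**: `D = D₀` (identity base functor), `Φ = Φ^{ℝ-log} =
ℤ²_{≥0}` with the shear (group-saturated; a GENUINE divisorial monoid on `D` for the tree's vocabulary),
`Φ^{bs-fld} = ℤ_{≥0}·e₁` monoprime (REAL), and Def. 3.6 (ii)(b): the constant `e₁ ∈ F₀^Λ` has the nonzero divisor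
`e₁/1`. [cite: MochizukiEtTh2009, Def 3.6 p.77] -/
def temperedFrobenioid : TemperedFrobenioid realified Base catVocab where
  isConnected := zigzag_isConnected fun j₁ j₂ =>
    (Zigzag.of_hom (WithTerminal.starTerminal.from j₁)).trans (Zigzag.of_inv (WithTerminal.starTerminal.from j₂))
  isTotallyEpimorphic := ⟨fun f => epi_base f⟩
  base := 𝟭 _
  Φ := ΦSub
  isGroupSaturated A := (isGroupSaturated_iff' _).2 fun _ _ _ _ _ _ => trivial
  isPerfFactorial _ := trivial
  isDivisorialOn := (treeCatVocab_isDivisorialOn Base _ _ _).2 ⟨isMonoidOn_Φ, fun A => isDivisorial_Φ (op A)⟩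
  isMonoprime_bsFld _ := IsMonoprime.ofZ ⟨⟨bsFldEquiv⟩⟩
  exists_FΛ_div_ne _ := ⟨Algebra.GrothendieckGroup.of (e 1), by
      change ψ₀ (Algebra.GrothendieckGroup.of (e 1)) = 1
      rw [ψ₀_of, χ₀_e_one],
    e 1, trivial, 1, trivial, e_ne_one _, by rw [map_one, div_one]; rfl⟩

/-- The base functor is the identity (so FULL and ESSENTIALLY SURJECTIVE — the shape of print's `D = D₀[𝒟] → D₀`).
[cite: MochizukiEtTh2009, Def 3.6 p.77] -/
theorem temperedFrobenioid_base : temperedFrobenioid.base = 𝟭 Base := rfl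

/-- "whose monoid type is `ℤ`". [cite: MochizukiEtTh2009, Def 4.1 p.86] -/
theorem temperedFrobenioid_monoidType : temperedFrobenioid.monoidType = MonoidType.Z := rfl

/-- `Φ` is objectwise divisorial ("`Φ` divisorial", the first law of the Prop. 4.2 (iii) floor).
[cite: MochizukiEtTh2009, Def 3.6 p.77] -/
theorem divisorMonoid_isDivisorial :
    Objectwise (fun N _ => IsDivisorial N) temperedFrobenioid.divisorMonoid := fun A => isDivisorial_Φ (op A)

/-! ### §5 The certificate: `hDSpull` FAILS -/

/-- `e₀` and `e₁` are COPRIME in `Φ(Y)` (no common non-trivial divisor).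
[cite: MochizukiEtTh2009, Def 4.1 (i) p.86] -/
theorem coprime_e (x : temperedFrobenioid.Φ.carrier (op Y))
    (h0 : x ∣ (⟨e 0, trivial⟩ : temperedFrobenioid.Φ.carrier (op Y)))
    (h1 : x ∣ (⟨e 1, trivial⟩ : temperedFrobenioid.Φ.carrier (op Y))) : x = 1 := by
  obtain ⟨c, hc⟩ := h0
  obtain ⟨d, hd⟩ := h1
  have h0' : (show M from x.1) ∣ e 0 := ⟨(show M from c.1), congrArg Subtype.val hc⟩
  have h1' : (show M from x.1) ∣ e 1 := ⟨(show M from d.1), congrArg Subtype.val hd⟩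
  rw [PiNat.dvd_iff] at h0' h1'
  have hx : (show M from x.1) = 1 := by
    refine PiNat.ext fun j => ?_
    rw [PiNat.coeff_one]
    fin_cases j
    · have := h1' 0
      rw [e, PiNat.coeff_single_of_ne (show (0 : Fin 2) ≠ 1 by decide)] at this
      exact Nat.le_zero.mp this
    · have := h0' 1
      rw [e, PiNat.coeff_single_of_ne (show (1 : Fin 2) ≠ 0 by decide)] at this
      exact Nat.le_zero.mp this
  exact Subtype.ext hx

/-- The pull-back of `e₀` along the cover is `e₀ + e₁`. [cite: MochizukiEtTh2009, Prop 4.2 p.89] -/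
theorem coe_pull_cov_e_zero :
    ((pull temperedFrobenioid.divisorMonoid cov
        (⟨e 0, trivial⟩ : temperedFrobenioid.Φ.carrier (op Y))).1 : M) = e 0 * e 1 :=
  shear_e_zero

/-- The pull-back of `e₁` along the cover is `e₁`. [cite: MochizukiEtTh2009, Prop 4.2 p.89] -/
theorem coe_pull_cov_e_one :
    ((pull temperedFrobenioid.divisorMonoid cov
        (⟨e 1, trivial⟩ : temperedFrobenioid.Φ.carrier (op Y))).1 : M) = e 1 :=
  shear_e_one

/-- **KERNEL CERTIFICATE for GAP G-w5d063-1: the «coprimality-pull-back law» `hDSpull` — VERBATIM the binder of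
`Prop42Sub.prop42_iii_iv_mkOfModelCanonical_of_laws` (p428253) and of every later law-level closer of [EtTh]
Prop. 4.2 (iii) — is FALSE at this tempered Frobenioid**: `e₀`, `e₁` are coprime over `Y`, their pull-backs
`e₀ + e₁`, `e₁` to the double cover `Y′` share the divisor `e₁ ≠ 0`. [cite: MochizukiEtTh2009, Prop 4.2 p.89] -/
theorem not_coprimePull :
    ¬ (∀ {A A' : Base} (f : A' ⟶ A) {a b : temperedFrobenioid.Φ.carrier (op A)},
        (∀ x : temperedFrobenioid.Φ.carrier (op A), x ∣ a → x ∣ b → x = 1) →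
          ∀ y : temperedFrobenioid.Φ.carrier (op A'), y ∣ pull temperedFrobenioid.divisorMonoid f a →
            y ∣ pull temperedFrobenioid.divisorMonoid f b → y = 1) := by
  intro h
  have hy : (⟨e 1, trivial⟩ : temperedFrobenioid.Φ.carrier (op Y')) = 1 :=
    h cov (a := ⟨e 0, trivial⟩) (b := ⟨e 1, trivial⟩) coprime_e ⟨e 1, trivial⟩
      (Dvd.intro ⟨e 0, trivial⟩ (Subtype.ext (coe_pull_cov_e_zero.trans (mul_comm _ _)).symm))
      (Dvd.intro 1 (Subtype.ext (coe_pull_cov_e_one.trans (mul_one _).symm).symm))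
  exact e_ne_one 1 (congrArg Subtype.val hy)

/-- Hence the universal closure of `hDSpull` over tempered Frobenioids — already over this one Def. 3.6 (i) datum and
with identity base functor — is FALSE: the law is independent of the typed structure.
[cite: MochizukiEtTh2009, Prop 4.2 p.89] -/
theorem not_forall_coprimePull :
    ¬ ∀ (tf : TemperedFrobenioid realified Base catVocab) {A A' : Base} (f : A' ⟶ A) {a b : tf.Φ.carrier (op A)},
        (∀ x : tf.Φ.carrier (op A), x ∣ a → x ∣ b → x = 1) →
          ∀ y : tf.Φ.carrier (op A'), y ∣ pull tf.divisorMonoid f a → y ∣ pull tf.divisorMonoid f b → y = 1 :=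
  fun h => not_coprimePull (fun f _ _ hab y hya hyb => h temperedFrobenioid f hab y hya hyb)

end ShearToy

end Literature.AnabelianGeometry.EtaleTheta

end
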